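import Summits.QuantumFields.YangMills.Theorems.BalabanUVNodesN19DefectGasManyClasses

/-!
# BalabanUVNodes ∕ node N19 (NE7) → node U5 → apex — THE IDEAL DEFECT-GAS TOWER RUN THROUGH THE SPINE'S OWN EXITS: consecutive levels of ONE tower (run B at `K` = run A at
# `K + 1`), ALL `2^{|Λ|}` classes good with ONE extensive constant, the E1∕E2 dictionary in CLOSED FORM (`Z_K(t) = Π_x (a_K(x)e^{t w_d(x)} + g_K e^{t w₀})` by `Finset.prod_add`),
# hence NE7 `MatchingModConstants`, `Σδ < ∞` and the CAUCHY property of the generating functions — a complete many-class worked instance of the N19 → U5 → U0 chain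

Cell `pub-ymgap` (HUMAN RULING D-0062 Track A ∕ D-0149 width seats), WIDTH SEAT `pub-ymgap-dag-n19-w1` (node n19 = NE7, seat 1 of 3), INTENT-4; successor of this seat's
`…Theorems.BalabanUVNodesN19DefectGasManyClasses` (INTENT-3).  Route `Summits/QuantumFields/YangMills/Theses/BalabanUVNodes.lean`, key item K3⁷ `SpineGivenEndpointR13SepCoPH`
(stmt-QuantumFields-20544); filed `--kind proof --supports … --as helper`.  COUNT-NEUTRAL.  THEOREMS ONLY (0 `def`, 0 `sorry`).  ADDITIVE — imports INTENT-3 (★★ `core_defectGas`,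
`defectTerm_pos`) and through it `T4MatchingAssembly` (`HybridNE7.cauchy`, `hybridNE7_noShell`), `T4WeightBudget` (`RelWeightBound`), `T4HybridMatching` (`hybridDelta`), `T4CauchySum`
(`MatchingModConstants`, `genFun`, `genFunLim`) and Mathlib's `Finset.prod_add` — CITED BY NAME; modifies nothing.

WHY.  INTENT-3 compared two runs at the same level; the spine's exits (`HybridNE7.matchingModConstants` ∕ `.cauchy`) read the TOWER dictionary `Z (K+1) = Σ_τ B K τ`, i.e. run B at
`K` is the next level of the same tower.  For the ideal defect gas this is the tower `a_K(x)`, `g_K` with CONVERGING relative fugacities (`|log(a_{K+1}∕a_K) − log(g_{K+1}∕g_K)| ≤ ε_K`,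
`Σ ε_K < ∞`); defects then do NOT become rare, so the bad class must be empty — with the threshold `n = |Λ|` every defect set is good and ALL `2^{|Λ|}` classes share the one extensive
constant `|Λ|·log(g_{K+1}∕g_K)` (INTENT-3's `core_defectGas`), NE7b holds with weight `0`, and the E1∕E2 dictionary is the binomial identity `Π_x (f(x) + g) = Σ_{D⊆Λ} Π_D f · Π_{Λ∖D} g`.  The
spine's U5∕U0 exits then deliver `MatchingModConstants vol l₀ (K ↦ |Λ|·ε_K∕vol) Z`, `Σ < ∞`, `CauchySeq (K ↦ genFun Z K t)` on `|t| ≤ l₀` and uniform convergence — for a `Z` one can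
write down.  (With INTENT-3 §4: the many-class `Core` used here is NOT recoverable from the conclusion.)
* [folklore] `bad_aboveCard_eq_empty` · `relWeightBound_defectTower` (weight `0`) · ★ `hybridNE7_defectTower` · `defectZ_eq_sum_classes` (E1∕E2 by `Finset.prod_add`) · `defectZ_pos` ·
  ★★ `cauchy_genFun_defectTower`.

HONEST FRAMING.  A finite TOY (product weights) run through the tree's own NE7 → apex bookkeeping — NOT King's model, NOT Bałaban's NE7 (NOT PRINTED), nothing of Bałaban's
instantiated; no estimate of the programme proved.  Count-neutral; N19 NOT discharged (0∕1); K3⁷ NOT claimed; counts UNMOVED (typed 28∕28 · discharged 5∕27).  Everything PROVED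
(0 `sorry`, 0 named facts, standard axioms).  One finite four-torus programme at fixed ε — NOT ℝ⁴, NOT OS, NOT a mass gap, NOT the Clay problem.
-/

noncomputable section

namespace Summit.QuantumFields.YangMills.BalabanUVNodes.N19DefectGasApex

open Real Filter Topology
open scoped BigOperators
open Summit.QuantumFields.BalabanUV.T4Continuum.Spine.NE7 (Core)
open Literature.MathematicalPhysics.QuantumFieldTheory.Balaban1983to89.T4WeightBudget (RelWeightBound)
open Literature.MathematicalPhysics.QuantumFieldTheory.Balaban1983to89.T4MatchingAssembly (HybridNE7 hybridNE7_noShell)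
open Literature.MathematicalPhysics.QuantumFieldTheory.Balaban1983to89.T4HybridMatching (hybridDelta)
open Literature.MathematicalPhysics.QuantumFieldTheory.Balaban1983to89.T4CauchySum (MatchingModConstants genFun genFunLim)
open Summit.QuantumFields.YangMills.BalabanUVNodes.N19DefectGasManyClasses (core_defectGas defectTerm_pos)

variable {α : Type*} [DecidableEq α] (Λ : Finset α) {l₀ vol w0 : ℝ} {wd : α → ℝ} {a : ℕ → α → ℝ} {g ε : ℕ → ℝ}

omit [DecidableEq α] in
/-- With the threshold `n = |Λ|` no defect set `D ⊆ Λ` is bad. [folklore] -/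
theorem bad_aboveCard_eq_empty : Λ.powerset.filter (fun D => Λ.card < D.card) = ∅ :=
  Finset.filter_eq_empty_iff.2 fun _ hD => not_lt.2 (Finset.card_le_card (Finset.mem_powerset.1 hD))

omit [DecidableEq α] in
/-- **NE7b WITH WEIGHT `0` ON THE DEFECT TOWER** [folklore]: the bad class `{|D| > |Λ|}` is empty, so `RelWeightBound l₀ powerset A B {|D| > |Λ|} 0` for ANY term families. -/
theorem relWeightBound_defectTower {A B : ℕ → ℝ → Finset α → ℝ} :
    RelWeightBound l₀ (fun _ => Λ.powerset) A B (fun _ _ => Λ.powerset.filter fun D => Λ.card < D.card) fun _ => 0 where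
  bad_subset _ _ _ := Finset.filter_subset _ _
  nonneg _ := le_rfl
  lt_one _ := zero_lt_one
  summable := summable_zero
  bad_left K t _ := by rw [bad_aboveCard_eq_empty, Finset.sum_empty, zero_mul]
  bad_right K t _ := by rw [bad_aboveCard_eq_empty, Finset.sum_empty, zero_mul]

/-- **★ `HybridNE7` ON THE DEFECT TOWER** [folklore ∘ INTENT-3 `core_defectGas` + `hybridNE7_noShell`]: consecutive levels `K`, `K + 1` of ONE tower of positive letters with
`|log(a_{K+1}(x)∕a_K(x)) − log(g_{K+1}∕g_K)| ≤ ε_K` on `Λ`, `ε ≥ 0` summable: ALL classes good (threshold `|Λ|`), weight `0`, no shells, remainder `δ_K = |Λ|·ε_K∕vol`, the one extensive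
constant `|Λ|·(log g_{K+1} − log g_K)`. -/
theorem hybridNE7_defectTower (hvol : 0 < vol) (hg : ∀ K, 0 < g K) (ha : ∀ K, ∀ x ∈ Λ, 0 < a K x) (hε0 : ∀ K, 0 ≤ ε K) (hεs : Summable ε)
    (hε : ∀ K, ∀ x ∈ Λ, |(Real.log (a (K + 1) x) - Real.log (a K x)) - (Real.log (g (K + 1)) - Real.log (g K))| ≤ ε K) :
    HybridNE7 l₀ vol (fun _ => Λ.powerset)
      (fun K t D => (∏ x ∈ D, a K x * Real.exp (t * wd x)) * ∏ _x ∈ Λ \ D, g K * Real.exp (t * w0))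
      (fun K t D => (∏ x ∈ D, a (K + 1) x * Real.exp (t * wd x)) * ∏ _x ∈ Λ \ D, g (K + 1) * Real.exp (t * w0))
      (fun _ _ => Λ.powerset.filter fun D => Λ.card < D.card) (fun _ => 0) (fun _ _ _ => 0) (fun _ _ _ => 0) (fun _ => 0)
      fun K => Λ.card * ε K / vol :=
  hybridNE7_noShell (relWeightBound_defectTower Λ)
    (fun K _ _ _ hD => (defectTerm_pos (fun x hx => ha K x (Finset.mem_powerset.1 hD hx)) (hg K)).le)
    (fun K _ _ _ hD => (defectTerm_pos (fun x hx => ha (K + 1) x (Finset.mem_powerset.1 hD hx)) (hg (K + 1))).le)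
    ((hεs.mul_left (Λ.card : ℝ)).div_const vol)
    (core_defectGas Λ Λ.card (a' := fun K => a (K + 1)) (g' := fun K => g (K + 1)) hvol hg (fun K => hg (K + 1)) ha (fun K => ha (K + 1)) hε0 hε)

/-- **THE E1∕E2 DICTIONARY IN CLOSED FORM** [folklore; Mathlib `Finset.prod_add`]: the defect-gas partition function is a product of single-site factors,
`Π_{x∈Λ} (a_K(x)e^{t w_d(x)} + g_K e^{t w₀}) = Σ_{D⊆Λ} (Π_{x∈D} a_K(x)e^{t w_d(x)})·(Π_{x∈Λ∖D} g_K e^{t w₀})`. -/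
theorem defectZ_eq_sum_classes (K : ℕ) (t : ℝ) :
    ∏ x ∈ Λ, (a K x * Real.exp (t * wd x) + g K * Real.exp (t * w0))
      = ∑ D ∈ Λ.powerset, (∏ x ∈ D, a K x * Real.exp (t * wd x)) * ∏ _x ∈ Λ \ D, g K * Real.exp (t * w0) :=
  Finset.prod_add (fun x => a K x * Real.exp (t * wd x)) (fun _ => g K * Real.exp (t * w0)) Λ

omit [DecidableEq α] in
/-- The defect-gas partition function is positive. [folklore] -/
theorem defectZ_pos (hg : ∀ K, 0 < g K) (ha : ∀ K, ∀ x ∈ Λ, 0 < a K x) (K : ℕ) (t : ℝ) :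
    0 < ∏ x ∈ Λ, (a K x * Real.exp (t * wd x) + g K * Real.exp (t * w0)) :=
  Finset.prod_pos fun x hx => add_pos (mul_pos (ha K x hx) (Real.exp_pos _)) (mul_pos (hg K) (Real.exp_pos _))

/-- **★★ NE7 AND THE CAUCHY PROPERTY OF THE GENERATING FUNCTIONS FOR THE IDEAL DEFECT-GAS TOWER, THROUGH THE SPINE'S OWN EXITS** [folklore ∘ `hybridNE7_defectTower` +
`T4MatchingAssembly.HybridNE7.cauchy`]: for `Z K t = Π_{x∈Λ} (a_K(x)e^{t w_d(x)} + g_K e^{t w₀})` with positive letters and converging relative fugacities (`Σ ε_K < ∞`), `vol > 0`,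
`l₀ ≥ 0`: `MatchingModConstants vol l₀ (K ↦ |Λ|·ε_K∕vol) Z`, summability of the remainder, `CauchySeq (K ↦ genFun Z K t)` for every `|t| ≤ l₀`, and uniform convergence on the
window to `genFunLim Z` — obtained from a `Core` with `2^{|Λ|}` good classes and ONE constant, via NE7b (weight `0`) and the E1∕E2 dictionary `defectZ_eq_sum_classes`. -/
theorem cauchy_genFun_defectTower (hvol : 0 < vol) (hl₀ : 0 ≤ l₀) (hg : ∀ K, 0 < g K) (ha : ∀ K, ∀ x ∈ Λ, 0 < a K x) (hε0 : ∀ K, 0 ≤ ε K)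
    (hεs : Summable ε) (hε : ∀ K, ∀ x ∈ Λ, |(Real.log (a (K + 1) x) - Real.log (a K x)) - (Real.log (g (K + 1)) - Real.log (g K))| ≤ ε K)
    {Z : ℕ → ℝ → ℝ} (hZ : ∀ K t, Z K t = ∏ x ∈ Λ, (a K x * Real.exp (t * wd x) + g K * Real.exp (t * w0))) :
    MatchingModConstants vol l₀ (fun K => Λ.card * ε K / vol) Z ∧ (Summable fun K => Λ.card * ε K / vol) ∧
      (∀ t : ℝ, |t| ≤ l₀ → CauchySeq fun K => genFun Z K t) ∧
      TendstoUniformlyOn (fun K t => genFun Z K t) (genFunLim Z) atTop {t | |t| ≤ l₀} := by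
  have h := (hybridNE7_defectTower Λ (l₀ := l₀) (wd := wd) (w0 := w0) hvol hg ha hε0 hεs hε).cauchy (Z := Z) hvol hl₀
    (fun K t _ => by rw [hZ, defectZ_eq_sum_classes]) (fun K t _ => by rw [hZ, defectZ_eq_sum_classes])
    (fun K t _ => by rw [← defectZ_eq_sum_classes]; exact defectZ_pos Λ hg ha K t)
  have hδ : hybridDelta vol (fun K => Λ.card * ε K / vol) (fun K => (0 : ℝ) + 0) = fun K => Λ.card * ε K / vol := by
    funext K
    simp [hybridDelta]
  rw [hδ] at h
  exact h

end Summit.QuantumFields.YangMills.BalabanUVNodes.N19DefectGasApex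

end
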